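import Mathlib.Data.Fintype.Pi
import Mathlib.Data.Fintype.BigOperators
import Mathlib.Data.Fintype.Powerset
import Mathlib.Algebra.Order.BigOperators.Group.Finset
import Mathlib.Data.List.TakeWhile
import HarnessLib

/-!
# PPSZ I: `Modify` with bounded implication, forced variables, and the counting lemma

Topic `Literature/Computability/FineGrained`, first file of the line `PPSZ*` formalising the
Paturi–Pudlák–Saks–Zane algorithm for `k`-SAT (J. ACM 52 (2005) 337–364) in the variant of
Hertli (SIAM J. Comput. 43 (2014), §2: "`D`-implication" replaces `s`-bounded resolution; the
analysis by critical clause trees is unchanged), towards the named fact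
`Literature.Computability.FineGrained.randSatExponent_four_lt_schoening` (`σ₄ < log₂ (3/2)`,
PPSZ Thm. 3) of `SatAlgorithms.lean`.

Setting (this file is pure combinatorics, no machines, no probability): a finite type `V` of
variables, literals `V × Bool` (the literal `(v, b)` is true under `a : V → Bool` iff `a v = b`),
clauses = lists of literals, CNF formulas = lists of clauses, partial assignments
`V → Option Bool`.

* `PPSZ.Entails S ρ l`: every total assignment compatible with the partial assignment `ρ` that
  satisfies the clause set `S` satisfies the literal `l`; `PPSZ.DImplies G D ρ l`: some at most
  `D` clauses of `G` entail `l` under `ρ` (Hertli's `D`-implication; PPSZ check instead whether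
  the unit clause `l` is in the `s`-bounded resolution closure `G_s` restricted by `ρ`).
* `PPSZ.modify G D ord y`: PPSZ's `Modify(G, π, y)` along the variable order `ord` (a list):
  each variable in turn is set to the `D`-implied value if there is one, else to the bit `y v`.
* `PPSZ.IsForced G D ord z v`: under the restriction of `z` to the variables preceding `v` in
  `ord`, the literal `(v, z v)` is `D`-implied (PPSZ's `Forced(G, π, z)`).
* `PPSZ.modify_eq_iff` (**PPSZ Lemma 1**): for a satisfying assignment `z`,
  `Modify(G, π, y) = z` iff `y` agrees with `z` on all variables that are not forced.
* `PPSZ.card_filter_modify_eq` (**PPSZ Lemma 2 / eq. (7)**, the counting form): among the `y` of a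
  subcube `B ∋ z` with defining variables `Dset`, exactly `2^{|Forced ∖ Dset|}` are mapped to `z`.

## References

* R. Paturi, P. Pudlák, M. E. Saks, F. Zane, *An improved exponential-time algorithm for k-SAT*,
  J. ACM 52(3) (2005) 337–364, doi:10.1145/1066100.1066101, §2 (Modify), §3.1 Lemmas 1–2,
  §4.1 eq. (7). [key `PaturiPudlakSaksZane2005`]
* T. Hertli, *3-SAT faster and simpler — unique-SAT bounds for PPSZ hold in general*,
  SIAM J. Comput. 43(2) (2014) 718–729, doi:10.1137/120868177 (arXiv:1103.2165, read
  2026-08-15), §2, Definition 3 (`s`-implication: "implied by a subformula with at most `s`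
  clauses", replacing `s`-bounded resolution; "the change to `s`-implication makes PPSZ only
  weaker"). We keep PPSZ's step-by-step `Modify` (not Hertli's eager variant) and call the
  bound `D`. [key `Hertli2014`]
-/

namespace Literature.Computability.FineGrained.PPSZ

variable {V : Type*}

/-! ### Clauses, formulas, assignments -/

/-- A CNF formula over the variables `V`: a list of clauses, each a list of literals `(v, b)`
(`b = true` for the positive literal `v`, `b = false` for `¬v`). [folklore] -/
abbrev CNF (V : Type*) := List (List (V × Bool))

/-- The total assignment `a` satisfies the clause `C`: some literal of `C` is true. [folklore] -/
def SatClause (a : V → Bool) (C : List (V × Bool)) : Prop := ∃ l ∈ C, a l.1 = l.2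

/-- The total assignment `a` satisfies the CNF `G`: it satisfies every clause. [folklore] -/
def Sat (a : V → Bool) (G : CNF V) : Prop := ∀ C ∈ G, SatClause a C

/-- Satisfaction of a clause is decidable (a finite disjunction). [folklore] -/
instance (a : V → Bool) (C : List (V × Bool)) : Decidable (SatClause a C) :=
  inferInstanceAs (Decidable (∃ l ∈ C, a l.1 = l.2))

/-- Satisfaction of a CNF is decidable (a finite conjunction). [folklore] -/
instance (a : V → Bool) (G : CNF V) : Decidable (Sat a G) :=
  inferInstanceAs (Decidable (∀ C ∈ G, SatClause a C))

/-- A total assignment `a` is compatible with the partial assignment `ρ` if it extends it. [folklore] -/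
def Compatible (ρ : V → Option Bool) (a : V → Bool) : Prop := ∀ v b, ρ v = some b → a v = b

/-! ### Bounded implication -/

/-- `Entails S ρ l`: the clause set `S`, restricted by the partial assignment `ρ`, semantically
implies the literal `l` — every total assignment compatible with `ρ` satisfying `S` makes `l`
true. [cite: Hertli2014, §2 Def. 3 (s-implication)] -/
def Entails (S : CNF V) (ρ : V → Option Bool) (l : V × Bool) : Prop :=
  ∀ a : V → Bool, Compatible ρ a → Sat a S → a l.1 = l.2

/-- **`D`-implication** `DImplies G D ρ l`: some at most `D` clauses of `G` entail the literal `l`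
under `ρ` (Hertli's "`F` `D`-implies `l`"; for PPSZ 2005 the corresponding test is membership of
the unit clause in the `s`-bounded resolution closure). [cite: Hertli2014, §2 Def. 3 (s-implication)] -/
def DImplies (G : CNF V) (D : ℕ) (ρ : V → Option Bool) (l : V × Bool) : Prop :=
  ∃ S : CNF V, S ⊆ G ∧ S.length ≤ D ∧ Entails S ρ l

/-- `D`-implication is monotone in `D`. [folklore] -/
theorem DImplies.mono {G : CNF V} {D D' : ℕ} {ρ : V → Option Bool} {l : V × Bool}
    (h : DImplies G D ρ l) (hD : D ≤ D') : DImplies G D' ρ l := by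
  obtain ⟨S, hS, hl, he⟩ := h
  exact ⟨S, hS, hl.trans hD, he⟩

/-- **No wrong forcing.** If `z` satisfies `G` and is compatible with `ρ`, then the negation of a
literal of `z` is never `D`-implied under `ρ`. (PPSZ 2005, proof of Lemma 1: "the clauses of `G`
force the output bit to be `z`".) [cite: PaturiPudlakSaksZane2005, Lemma 1 (proof)] -/
theorem not_dImplies_not {G : CNF V} {D : ℕ} {ρ : V → Option Bool} {z : V → Bool} (hz : Sat z G)
    (hρ : Compatible ρ z) (v : V) : ¬ DImplies G D ρ (v, !z v) := by
  rintro ⟨S, hS, -, he⟩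
  have h := he z hρ (fun C hC => hz C (hS hC))
  simp at h

/-! ### Restrictions and `Modify` along a variable order -/

section Modify

variable [DecidableEq V]

/-- The restriction `z↾P` of a total assignment to a set of variables, as a partial assignment. [folklore] -/
def restrict (z : V → Bool) (P : Finset V) : V → Option Bool := fun v => if v ∈ P then some (z v) else none

/-- `z` is compatible with each of its restrictions. [folklore] -/
theorem compatible_restrict (z : V → Bool) (P : Finset V) : Compatible (restrict z P) z := by
  intro v b h
  unfold restrict at h
  split_ifs at h with hv
  exact Option.some.inj h

/-- Compatibility with a restriction `z↾P` is agreement with `z` on `P`. [folklore] -/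
theorem compatible_restrict_iff (z : V → Bool) (P : Finset V) (a : V → Bool) :
    Compatible (restrict z P) a ↔ ∀ v ∈ P, a v = z v := by
  constructor
  · intro h v hv
    exact h v (z v) (by simp [restrict, hv])
  · intro h v b hb
    unfold restrict at hb
    split_ifs at hb with hv
    rw [h v hv]; exact Option.some.inj hb

/-- Extending a restriction by one more variable is a `Function.update`. [folklore] -/
theorem update_restrict (z : V → Bool) (P : Finset V) (v : V) :
    Function.update (restrict z P) v (some (z v)) = restrict z (insert v P) := by
  funext w
  by_cases hw : w = v
  · subst hw; simp [restrict]
  · rw [Function.update_of_ne hw]; simp [restrict, hw]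

/-- The bit PPSZ's `Modify` gives to variable `v` when the variables assigned so far form the
partial assignment `ρ`: the `D`-implied value if `(v, true)` or `(v, false)` is `D`-implied,
otherwise the default bit `y v`. [cite: PaturiPudlakSaksZane2005, §2 (Function Modify)] -/
noncomputable def value (G : CNF V) (D : ℕ) (y : V → Bool) (ρ : V → Option Bool) (v : V) : Bool :=
  open scoped Classical in
  if DImplies G D ρ (v, true) then true else if DImplies G D ρ (v, false) then false else y v

/-- `Modify` as a fold: process the variables of `ord` in turn, extending the partial assignment
`ρ` by `value`. [cite: PaturiPudlakSaksZane2005, §2 (Function Modify)] -/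
noncomputable def modifyAux (G : CNF V) (D : ℕ) (y : V → Bool) :
    List V → (V → Option Bool) → (V → Option Bool)
  | [], ρ => ρ
  | v :: ord, ρ => modifyAux G D y ord (Function.update ρ v (some (value G D y ρ v)))

/-- **PPSZ's `Modify(G, π, y)`** with `D`-implication, the variables being processed in the
order of the list `ord` (the permutation `π`); variables not in `ord` keep their bit `y v`.
[cite: PaturiPudlakSaksZane2005, §2 (Function Modify)] -/
noncomputable def modify (G : CNF V) (D : ℕ) (ord : List V) (y : V → Bool) : V → Bool :=
  fun v => (modifyAux G D y ord (fun _ => none) v).getD (y v)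

/-- The variables preceding `v` in the order `ord`. [folklore] -/
def before (ord : List V) (v : V) : Finset V := (ord.takeWhile fun w => !decide (w = v)).toFinset

/-- **Forced variables** (PPSZ's `Forced(G, π, z)`, for `D`-implication): `v` is forced for
`(G, ord, z)` if the literal `(v, z v)` is `D`-implied under the restriction of `z` to the
variables preceding `v`. [cite: PaturiPudlakSaksZane2005, §3.1 (Forced(G, π, z))] -/
def IsForced (G : CNF V) (D : ℕ) (ord : List V) (z : V → Bool) (v : V) : Prop :=
  DImplies G D (restrict z (before ord v)) (v, z v)

/-- In an order `done ++ v :: rest` without repetitions, the variables before `v` are those of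
`done`. [folklore] -/
theorem before_append_cons {done rest : List V} {v : V} (hv : v ∉ done) :
    before (done ++ v :: rest) v = done.toFinset := by
  unfold before
  rw [List.takeWhile_append_of_pos]
  · simp
  · intro w hw
    have : w ≠ v := fun h => hv (h ▸ hw)
    simp [this]

omit [DecidableEq V] in
/-- The value given to `v` is `z v` whenever `z` satisfies `G`, is compatible with the current
partial assignment, and either `(v, z v)` is `D`-implied or the default bit is already `z v`.
[cite: PaturiPudlakSaksZane2005, Lemma 1 (proof, first paragraph)] -/
theorem value_eq_of_sat {G : CNF V} {D : ℕ} {y z : V → Bool} {ρ : V → Option Bool} (hz : Sat z G)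
    (hρ : Compatible ρ z) {v : V} (h : DImplies G D ρ (v, z v) ∨ y v = z v) :
    value G D y ρ v = z v := by
  have hn := not_dImplies_not (D := D) hz hρ v
  unfold value
  cases hzv : z v
  · rw [hzv] at hn h
    simp only [Bool.not_false] at hn
    rw [if_neg hn]
    split_ifs with h2
    · rfl
    · rcases h with h | h
      · exact absurd h h2
      · exact h
  · rw [hzv] at hn h
    simp only [Bool.not_true] at hn
    split_ifs with h1
    · rfl
    · rcases h with h | h
      · exact absurd h h1
      · exact h

omit [DecidableEq V] in
/-- If `(v, z v)` is not `D`-implied (and `z` satisfies `G`, compatible with `ρ`), the value given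
to `v` is the default bit `y v`. [cite: PaturiPudlakSaksZane2005, Lemma 1 (proof, second paragraph)] -/
theorem value_eq_of_not_dImplies {G : CNF V} {D : ℕ} {y z : V → Bool} {ρ : V → Option Bool}
    (hz : Sat z G) (hρ : Compatible ρ z) {v : V} (h : ¬ DImplies G D ρ (v, z v)) :
    value G D y ρ v = y v := by
  have hn := not_dImplies_not (D := D) hz hρ v
  unfold value
  cases hzv : z v
  · rw [hzv] at hn h
    simp only [Bool.not_false] at hn
    rw [if_neg hn, if_neg h]
  · rw [hzv] at hn h
    simp only [Bool.not_true] at hn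
    rw [if_neg h, if_neg hn]

/-- `modifyAux` does not change the entries of variables outside the list. [folklore] -/
theorem modifyAux_apply_of_not_mem (G : CNF V) (D : ℕ) (y : V → Bool) :
    ∀ (ord : List V) (ρ : V → Option Bool) {v : V}, v ∉ ord → modifyAux G D y ord ρ v = ρ v
  | [], ρ, v, _ => rfl
  | w :: ord, ρ, v, hv => by
    rw [List.mem_cons, not_or] at hv
    rw [modifyAux, modifyAux_apply_of_not_mem G D y ord _ hv.2, Function.update_of_ne hv.1]

/-- The inductive form of Lemma 1 along a split order `done ++ rest`, the processed part agreeing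
with `z`. [cite: PaturiPudlakSaksZane2005, Lemma 1] -/
theorem modifyAux_eq_iff {G : CNF V} {D : ℕ} {y z : V → Bool} (hz : Sat z G) :
    ∀ (rest done : List V), (done ++ rest).Nodup →
      ((∀ v ∈ rest, modifyAux G D y rest (restrict z done.toFinset) v = some (z v)) ↔
        ∀ v ∈ rest, ¬ IsForced G D (done ++ rest) z v → y v = z v)
  | [], done, _ => by simp
  | v :: rest, done, hnd => by
    have hvd : v ∉ done := fun h => by
      have := List.nodup_append.1 hnd
      exact (this.2.2 v h v (by simp)) rfl
    have hvr : v ∉ rest := fun h => by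
      have := (List.nodup_append.1 hnd).2.1
      exact (List.nodup_cons.1 this).1 h
    have hnd' : ((done ++ [v]) ++ rest).Nodup := by simpa using hnd
    have ih := modifyAux_eq_iff (D := D) (y := y) hz rest (done ++ [v]) hnd'
    have hbef : IsForced G D (done ++ v :: rest) z v ↔
        DImplies G D (restrict z done.toFinset) (v, z v) := by
      unfold IsForced; rw [before_append_cons hvd]
    have hρ := compatible_restrict z done.toFinset
    have heq : (done ++ [v]) ++ rest = done ++ v :: rest := by simp
    rw [heq] at ih
    have htf : (done ++ [v]).toFinset = insert v done.toFinset := by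
      ext w; simp
    rw [htf] at ih
    by_cases hgood : DImplies G D (restrict z done.toFinset) (v, z v) ∨ y v = z v
    · -- the head variable receives `z v`
      have hval := value_eq_of_sat (y := y) hz hρ hgood
      have hstep : modifyAux G D y (v :: rest) (restrict z done.toFinset) =
          modifyAux G D y rest (restrict z (insert v done.toFinset)) := by
        rw [modifyAux, hval, update_restrict]
      rw [hstep]
      constructor
      · intro h w hw
        rcases List.mem_cons.1 hw with rfl | hw'
        · intro hnf; rw [hbef] at hnf
          exact hgood.resolve_left hnf
        · exact (ih.1 fun u hu => h u (List.mem_cons_of_mem _ hu)) w hw'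
      · intro h w hw
        rcases List.mem_cons.1 hw with rfl | hw'
        · rw [modifyAux_apply_of_not_mem G D y rest _ hvr]
          simp [restrict]
        · exact (ih.2 fun u hu => h u (List.mem_cons_of_mem _ hu)) w hw'
    · -- the head variable is unforced and receives `y v ≠ z v`
      rw [not_or] at hgood
      have hval := value_eq_of_not_dImplies (y := y) hz hρ hgood.1
      constructor
      · intro h
        have hv := h v (by simp)
        rw [modifyAux, modifyAux_apply_of_not_mem G D y rest _ hvr, Function.update_self,
          hval] at hv
        exact absurd (Option.some.inj hv) hgood.2
      · intro h
        exact absurd (h v (by simp) (fun hf => hgood.1 (hbef.1 hf))) hgood.2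

/-- **PPSZ Lemma 1** (for `D`-implication). Let `z` satisfy `G` and let `ord` be an order
without repetitions. Then `Modify(G, ord, y)` agrees with `z` on the variables of `ord` if and
only if `y` agrees with `z` on every variable of `ord` that is not forced for `(G, ord, z)`.
[cite: PaturiPudlakSaksZane2005, Lemma 1] -/
theorem modify_eq_iff {G : CNF V} {D : ℕ} {ord : List V} (hord : ord.Nodup) {y z : V → Bool}
    (hz : Sat z G) :
    (∀ v ∈ ord, modify G D ord y v = z v) ↔ ∀ v ∈ ord, ¬ IsForced G D ord z v → y v = z v := by
  have h := modifyAux_eq_iff (D := D) (y := y) hz ord [] (by simpa using hord)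
  simp only [List.nil_append, List.toFinset_nil] at h
  have h0 : restrict z (∅ : Finset V) = fun _ => none := by funext w; simp [restrict]
  rw [h0] at h
  rw [← h]
  refine forall₂_congr fun v hv => ?_
  unfold modify
  constructor
  · intro he
    -- the entry of `v ∈ ord` is `some _`
    obtain ⟨b, hb⟩ : ∃ b, modifyAux G D y ord (fun _ => none) v = some b := by
      clear he h
      suffices ∀ (l : List V) (ρ : V → Option Bool), v ∈ l ∨ (∃ b, ρ v = some b) →
          ∃ b, modifyAux G D y l ρ v = some b from this ord _ (Or.inl hv)
      intro l
      induction l with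
      | nil =>
        intro ρ h
        rcases h with h | h
        · simp at h
        · simpa [modifyAux] using h
      | cons w l ihl =>
        intro ρ h
        rw [modifyAux]
        apply ihl
        by_cases hwv : v = w
        · subst hwv; exact Or.inr ⟨_, Function.update_self _ _ _⟩
        · rcases h with h | h
          · exact Or.inl ((List.mem_cons.1 h).resolve_left hwv)
          · right; rwa [Function.update_of_ne hwv]
    rw [hb] at he ⊢
    simpa using he
  · intro he; rw [he]; rfl

/-! ### The counting lemma -/

variable [Fintype V]

/-- The assignments agreeing with `z` outside the set `F` are in bijection with the functions
`F → Bool`; hence there are `2^{|F|}` of them. [folklore] -/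
theorem card_filter_agree_off (z : V → Bool) (F : Finset V) :
    (Finset.univ.filter fun y : V → Bool => ∀ v, v ∉ F → y v = z v).card = 2 ^ F.card := by
  classical
  let e : {y : V → Bool // ∀ v, v ∉ F → y v = z v} ≃ (F → Bool) :=
    { toFun := fun y w => y.1 w
      invFun := fun f => ⟨fun v => if h : v ∈ F then f ⟨v, h⟩ else z v, fun v hv => by simp [hv]⟩
      left_inv := by
        rintro ⟨y, hy⟩; ext v
        by_cases hv : v ∈ F
        · simp [hv]
        · simp [hv, hy v hv]
      right_inv := by intro f; ext ⟨w, hw⟩; simp [hw] }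
  rw [← Fintype.card_subtype, Fintype.card_congr e, Fintype.card_fun, Fintype.card_bool,
    Fintype.card_coe]

/-- **PPSZ Lemma 2 / eq. (7), counting form.** Let `z` satisfy `G`, let `ord` enumerate all
variables without repetition, and let `Dset` be a set of variables (the defining variables of a
subcube `B ∋ z`). The assignments `y ∈ B` (i.e. agreeing with `z` on `Dset`) with
`Modify(G, ord, y) = z` are exactly those agreeing with `z` outside the forced variables not in
`Dset`; there are `2^{|Forced ∖ Dset|}` of them. [cite: PaturiPudlakSaksZane2005, Lemma 2 and eq. (7)] -/
theorem card_filter_modify_eq {G : CNF V} {D : ℕ} {ord : List V} (hord : ord.Nodup)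
    (hall : ∀ v, v ∈ ord) {z : V → Bool} (hz : Sat z G) (Dset : Finset V) :
    open scoped Classical in
    (Finset.univ.filter fun y : V → Bool =>
        (∀ v ∈ Dset, y v = z v) ∧ modify G D ord y = z).card =
      2 ^ (Finset.univ.filter fun v => v ∉ Dset ∧ IsForced G D ord z v).card := by
  classical
  rw [← card_filter_agree_off z]
  congr 1
  refine Finset.filter_congr fun y _ => ?_
  have h1 := modify_eq_iff (D := D) hord (y := y) hz
  simp only [Finset.mem_filter, Finset.mem_univ, true_and, not_and]
  constructor
  · rintro ⟨hD, hm⟩ v hv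
    by_cases hvD : v ∈ Dset
    · exact hD v hvD
    · exact h1.1 (fun w _ => by rw [hm]) v (hall v) (fun hf => (hv hvD) hf |>.elim)
  · intro h
    refine ⟨fun v hv => h v (fun hnv => (hnv hv).elim), ?_⟩
    funext v
    exact (h1.2 fun w _ hnf => h w (fun hwD hf => hnf hf)) v (hall v)

end Modify

end Literature.Computability.FineGrained.PPSZ
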